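import Summits.BirchSwinnertonDyer.BirchSwinnertonDyer.Theorems.ManinLocalTwoThreeCuspZeroAnnihilatorOfCuspGalois
import Summits.BirchSwinnertonDyer.BirchSwinnertonDyer.Theorems.ManinLocalTwoThreeStevensCuspZeroGaloisOrbit
import Summits.BirchSwinnertonDyer.BirchSwinnertonDyer.Theorems.ManinLocalTwoThreeStevensCuspZeroRational
import Summits.BirchSwinnertonDyer.BirchSwinnertonDyer.Theorems.ManinLocalTwoThreeStevensShimuraKernelRational
import Summits.BirchSwinnertonDyer.BirchSwinnertonDyer.Theorems.ManinLocalTwoThreeShimuraThreeTorsionOfCuspLifting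
import Summits.BirchSwinnertonDyer.Rank1Residual.ManinAdditive.HesseOptimalityAtThree
import HarnessLib

/-!
# The cusp-lifting laws are THEOREMS: Θ (es E-es-80) for EVERY `X₀(N)`-datum, and E-an-128 / 128ℓ / 128₄ by name, UNCONDITIONAL
(route `ManinLocalTwoThree`, cruxes C2 `ManinOddAtFour` stmt-BirchSwinnertonDyer-22967 / C3 `ManinPrimeToThreeAtNine` stmt-…-22968;
cell bsd-f2-manin, prover seat p3 gen 21; `--supports stmt-BirchSwinnertonDyer-22967`)

an g41's `…CuspZeroAnnihilatorOfCuspGalois` (landed by p3 g17) proved es's annihilator law Θ and an's cusp-lifting laws E-an-128 / 128ℓ / 128₄ / 128₂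
MODULO four printed inputs: F★₀ `optimalParametrization_cuspZero_rational`, F★ `optimalGamma1Parametrization_cusp_rational`, F♮
`optimalGamma1Parametrization_cuspZero_galoisConjugate` (there the binder `hB`) and CES `exists_optimal_gamma1ParametrizationData`.  All four are now
supplied by the tree: F★₀ (`StevensCurve.optimalParametrization_cuspZero_rational_holds`, p767969), F★ (`StevensGalois.optimalGamma1Parametrization_cusp_rational_holds`,
LEAD p1 g22 / p2 g23), F♮ (`StevensGalois.optimalGamma1Parametrization_cuspZero_galoisConjugate_holds`, es g42 T-es-78 = p768012), and — in place of
CES — p2 g23's lattice-clause-free Stevens twin `CuspValues.exists_optimal_gamma1ParametrizationData_flat_of_datum` (an OPTIMAL `X₁(N)`-datum with the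
same newform on an isogenous curve, for an ARBITRARY `X₀(N)`-datum).  Hence, fact-free and unconditional:

* §1 **Θ = es E-es-80 `KatoCurve.CuspZeroAnnihilatesShimuraQuotient` BY NAME** (`cuspZeroAnnihilatesShimuraQuotient_holds`): for EVERY `X₀(N)`-datum
  `D` (no lattice clause, no minimality) and `m : ℕ`, `m·{∞,0}_f ∈ Λ₀(f) ⟹ m·Λ₀(f) ⊆ Λ₁(f)`.
* §2 the glue `exists_addOrderOf_eq_primePow` / `exists_addOrderOf_eq_prime` (an g41's, with the four inputs discharged): a Shimura `ℓᵏ`-kernel of a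
  lattice-optimal `X₀(N)`-datum forces a RATIONAL point of order exactly `ℓᵏ` on the optimal curve itself (global minimality not needed).
* §3 **E-an-128 `ShimuraThreeForcesRationalThreeTorsion`, E-an-128ℓ `ShimuraOddPrimeForcesRationalTorsion`, E-an-128₄ `ShimuraFourForcesRationalFourTorsion`
  BY NAME, UNCONDITIONAL** (E-an-128₂ is already `shimuraTwoForcesRationalTwoTorsion_holds`, LEAD g9, by the mod-`2` road).
* §4 the by-name cascade: E-an-221 `ShimuraThreeKernelForcesRationalThreeTorsionAtNine` (the last non-printed stub of the C3 skeleton v33),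
  E-an-222-tame `ShimuraThreeForcesRationalThreeTorsionAtTameNine`, `PlusIndexPrimeToThreeOfNoRationalThreeTorsion`, `PlusIndexPrimeToThreeOfMuThreeAt27`,
  `PlusIndexPrimeToThreeOfMuThreeNoRationalThreeTorsion` — all THEOREMS now (their tree glue `…_of_cuspLifting` applied to §3).

HONEST FRAMING: unconditional, fact-free, standard axioms.  an's header records E-an-128/128ℓ/128₄ as «NOT in print as stated» (print: Stevens 1982 /
Vatsal 2005 Rem. 1.8 give the constant kernel of the Shimura cover, not the `X₀`-optimal torsion consequence); they are now kernel theorems.  C3 thereby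
rests, along the v33 skeleton, on {Kato F₃♮, CDT} — no better than the tree's C3 ⟸ CDT (p763630).  C2/C3, Manin's conjecture and BSD are NOT proved.
No definitions, no sorry.
[cite: Stevens1982, §1.3 Thm. 1.3.1] [cite: Stevens1989, Thm. 1.9, §2] [cite: Vatsal2005, Thm. 1.17, Rem. 1.8, Rem. 1.18] [cite: Manin1972, Thm. 1.9, Cor. 3.6]
[cite: ConradEdixhovenStein2003, §6.1.2, Thm. 1.1.3]
-/

set_option autoImplicit false
-- lint-debt: the directory name repeats the summit name (sibling precedent `ManinLocalTwoThreeCuspZeroAnnihilatorOfCuspGalois.lean`)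
set_option linter.dupNamespace false

open scoped Classical MatrixGroups ModularForm
open CongruenceSubgroup WeierstrassCurve Literature.NumberTheory.EllipticCurves Literature.NumberTheory.EllipticCurves.ModularForms
open Summit.BirchSwinnertonDyer.Rank1Residual.ManinAdditive Summit.BirchSwinnertonDyer.Rank1Residual.ManinAdditive.KatoCurve
open Summit.BirchSwinnertonDyer.Rank1Residual.ManinAdditive.HesseOptimality
open Summit.BirchSwinnertonDyer.Rank1Residual.ManinAdditive.ShimuraThreeTorsion

namespace Summit.BirchSwinnertonDyer.BirchSwinnertonDyer.Theorems.ManinLocalTwoThree.CuspLifting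

/-! ### §1. Θ for every `X₀(N)`-datum -/

/-- **Θ (es E-es-80), UNCONDITIONAL, for EVERY `X₀(N)`-datum**: `m·{∞,0}_f ∈ Λ₀(f) ⟹ m·Λ₀(f) ⊆ Λ₁(f)`.  an g41's `X₁`-optimal core
`CuspGalois.periodLattice_mul_mem_periodLatticeGamma1_of_isOptimal` run on p2's Stevens twin, with F♮ and F★ supplied by their tree theorems.
[cite: Stevens1982, §1.3 Thm. 1.3.1] [cite: Stevens1989, §2] [cite: Vatsal2005, Rem. 1.8] -/
theorem cuspZeroAnnihilates {W : WeierstrassCurve ℚ} [W.IsElliptic] {N : ℕ} [NeZero N] (D : ModularParametrizationData W N) (m : ℕ)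
    (hm : (m : ℂ) * modularSymbol D.f 0 ∈ periodLattice D.f) :
    ∀ x ∈ periodLattice D.f, (m : ℂ) * x ∈ periodLatticeGamma1 D.f := by
  obtain ⟨W₁, hW₁, D₁, hf, -, hD₁, -, -⟩ := CuspValues.exists_optimal_gamma1ParametrizationData_flat_of_datum D
  rw [← hf] at hm ⊢
  exact CuspGalois.periodLattice_mul_mem_periodLatticeGamma1_of_isOptimal
    StevensGalois.optimalGamma1Parametrization_cuspZero_galoisConjugate_holds
    StevensGalois.optimalGamma1Parametrization_cusp_rational_holds D₁ hD₁ m hm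

/-- **es E-es-80 `KatoCurve.CuspZeroAnnihilatesShimuraQuotient` HOLDS** (by name, unconditional). [cite: Stevens1989, §2, La. 3.11] [cite: Vatsal2005, Thm. 1.17] -/
theorem cuspZeroAnnihilatesShimuraQuotient_holds : CuspZeroAnnihilatesShimuraQuotient :=
  fun _ _ _ _ D m hm ↦ cuspZeroAnnihilates D m hm

/-! ### §2. The glue: a Shimura `ℓᵏ`-kernel forces a rational point of order `ℓᵏ` on the lattice-optimal curve -/

section Glue

variable {W : WeierstrassCurve ℚ} [W.IsElliptic] {N : ℕ} [NeZero N]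

/-- **A Shimura `ℓᵏ`-kernel forces a RATIONAL point of order exactly `ℓᵏ` on the lattice-optimal curve** (an g41's
`CuspGalois.exists_addOrderOf_eq_primePow_of_cuspGalois` with F★₀, F★, F♮, CES discharged; `P ∈ W(ℚ)` over `φ(0)`, `n = ord P` finite by
Manin–Drinfeld, `n{∞,0}_f ∈ Λ₀` so `n` kills `Λ₀/Λ₁` by Θ, Bézout gives `ℓᵏ ∣ n`, `(n/ℓᵏ)•P` has order `ℓᵏ`).
[cite: Manin1972, Thm. 1.9, Cor. 3.6] [cite: Vatsal2005, Rem. 1.18] -/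
theorem exists_addOrderOf_eq_primePow (D : ModularParametrizationData W N)
    (hopt : ∀ z ∈ D.L.lattice, ∃ w ∈ periodLattice D.f, z = D.c * w) {ℓ k : ℕ} (hℓ : ℓ.Prime)
    (hx : ∃ x ∈ periodLattice D.f, ((ℓ ^ k : ℕ) : ℂ) * x ∈ periodLatticeGamma1 D.f ∧
      ((ℓ ^ (k - 1) : ℕ) : ℂ) * x ∉ periodLatticeGamma1 D.f) :
    ∃ Q : W.toAffine.Point, addOrderOf Q = ℓ ^ k := by
  obtain ⟨P, hP⟩ := StevensCurve.exists_ratPoint_eq_uniformize_cuspZero D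
  obtain ⟨x, hxΛ, hℓk, hℓk1⟩ := hx
  -- `φ(0)` is torsion (Manin–Drinfeld), hence so is `P` (the base-change map is injective)
  set ι := Affine.Point.baseChange (W' := W) ℚ ℂ with hι
  have hιinj : Function.Injective ι := Affine.Point.map_injective _
  have hordP : addOrderOf (ι P) = addOrderOf P := addOrderOf_injective ι hιinj P
  obtain ⟨m, hm, hmΛ⟩ := exists_nsmul_modularSymbol_mem_periodLattice_of_isNewform0
    D.isNewformOf.1 D.isNewformOf.coeffField_eq_bot 0
  have hmP : m • ι P = 0 := by
    rw [hP, CuspGalois.nsmul_uniformize_cuspZero_eq_zero_iff' D hopt]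
    rwa [nsmul_eq_mul] at hmΛ
  have hfin : IsOfFinAddOrder (ι P) := isOfFinAddOrder_iff_nsmul_eq_zero.mpr ⟨m, hm, hmP⟩
  set n := addOrderOf (ι P) with hn
  have hn0 : n ≠ 0 := (hfin.addOrderOf_pos).ne'
  -- `n·{∞,0}_f ∈ Λ₀`, so `n` kills `Λ₀/Λ₁` (Θ, §1)
  have hnΛ : (n : ℂ) * modularSymbol D.f 0 ∈ periodLattice D.f := by
    rw [← CuspGalois.nsmul_uniformize_cuspZero_eq_zero_iff' D hopt, ← hP]
    exact addOrderOf_nsmul_eq_zero (ι P)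
  have hnx : (n : ℂ) * x ∈ periodLatticeGamma1 D.f := cuspZeroAnnihilates D n hnΛ x hxΛ
  -- hence `ℓᵏ ∣ n`
  have hdvd : ℓ ^ k ∣ n := by
    have hg : ((Nat.gcd n (ℓ ^ k) : ℕ) : ℂ) * x ∈ periodLatticeGamma1 D.f := gcd_mul_mem hnx hℓk
    obtain ⟨j, hjk, hj⟩ := (Nat.dvd_prime_pow hℓ).1 (Nat.gcd_dvd_right n (ℓ ^ k))
    rcases hjk.lt_or_eq with hlt | heq
    · exfalso
      apply hℓk1
      have hsplit : ℓ ^ (k - 1) = ℓ ^ (k - 1 - j) * ℓ ^ j := by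
        rw [← pow_add]; congr 1; omega
      rw [hsplit, Nat.cast_mul, mul_assoc, ← hj]
      exact natCast_mul_mem hg _
    · rw [← heq, ← hj]; exact Nat.gcd_dvd_left n (ℓ ^ k)
  -- the rational point `(n/ℓᵏ)·P` has order exactly `ℓᵏ`
  have hq0 : n / ℓ ^ k ≠ 0 := (Nat.div_pos (Nat.le_of_dvd (Nat.pos_of_ne_zero hn0) hdvd) (pow_pos hℓ.pos k)).ne'
  have hordQ : addOrderOf ((n / ℓ ^ k) • P) = ℓ ^ k := by
    rw [addOrderOf_nsmul_of_dvd hq0 (hordP ▸ Nat.div_dvd_of_dvd hdvd), ← hordP, Nat.div_div_self hdvd hn0]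
  exact ⟨(n / ℓ ^ k) • P, hordQ⟩

/-- The `k = 1` case: a Shimura `ℓ`-kernel (`¬ ShimuraIndexPrimeTo ℓ f`) of a lattice-optimal datum forces a rational point of order `ℓ`.
[cite: Vatsal2005, Rem. 1.18] -/
theorem exists_addOrderOf_eq_prime (D : ModularParametrizationData W N)
    (hopt : ∀ z ∈ D.L.lattice, ∃ w ∈ periodLattice D.f, z = D.c * w) {ℓ : ℕ} (hℓ : ℓ.Prime) (hS : ¬ ShimuraIndexPrimeTo ℓ D.f) :
    ∃ Q : W.toAffine.Point, addOrderOf Q = ℓ := by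
  have hx : ∃ x ∈ periodLattice D.f, ((ℓ ^ 1 : ℕ) : ℂ) * x ∈ periodLatticeGamma1 D.f ∧
      ((ℓ ^ (1 - 1) : ℕ) : ℂ) * x ∉ periodLatticeGamma1 D.f := by
    simp only [ShimuraIndexPrimeTo, not_forall, exists_prop] at hS
    obtain ⟨x, hx, hℓx, hxn⟩ := hS
    exact ⟨x, hx, by simpa using hℓx, by simpa using hxn⟩
  simpa using exists_addOrderOf_eq_primePow D hopt hℓ hx

end Glue

/-! ### §3. E-an-128 / 128ℓ / 128₄ by name, UNCONDITIONAL -/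

/-- **E-an-128 `ShimuraThreeForcesRationalThreeTorsion` HOLDS**: `3 ∣ [Λ₀(f) : Λ₁(f)]` forces a rational `3`-torsion point on the lattice-optimal
(globally minimal) curve, in an's short-model currency (`exists_isShortThreeTorsion_of_addOrderOf_eq_three`). [cite: Vatsal2005, Thm. 1.17, Rem. 1.18] -/
theorem shimuraThreeForcesRationalThreeTorsion_holds : ShimuraThreeForcesRationalThreeTorsion := by
  intro W _ _ N _ D hopt hS
  obtain ⟨Q, hQ⟩ := exists_addOrderOf_eq_prime D hopt Nat.prime_three hS
  have hc : D.c ≠ 0 := fun h ↦ cast_c_ne_zero_of_latticeOptimal D hopt (by rw [h]; simp)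
  exact exists_isShortThreeTorsion_of_addOrderOf_eq_three W hc hQ

/-- **E-an-128ℓ `ShimuraOddPrimeForcesRationalTorsion` HOLDS**: `ℓ ∣ [Λ₀(f) : Λ₁(f)]` (`ℓ` an odd prime) forces a rational point of order `ℓ`
on the lattice-optimal curve. [cite: Vatsal2005, Thm. 1.17, Rem. 1.18] -/
theorem shimuraOddPrimeForcesRationalTorsion_holds : ShimuraOddPrimeForcesRationalTorsion := by
  intro W _ _ N _ D ℓ hℓ _ hopt hS
  exact exists_addOrderOf_eq_prime D hopt hℓ hS

/-- **E-an-128₄ `ShimuraFourForcesRationalFourTorsion` HOLDS**: a Shimura `4`-kernel forces a rational point of order `4` on the lattice-optimal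
curve. [cite: Vatsal2005, Thm. 1.17] -/
theorem shimuraFourForcesRationalFourTorsion_holds : ShimuraFourForcesRationalFourTorsion := by
  intro W _ _ N _ D hopt hx
  have hx' : ∃ x ∈ periodLattice D.f, ((2 ^ 2 : ℕ) : ℂ) * x ∈ periodLatticeGamma1 D.f ∧
      ((2 ^ (2 - 1) : ℕ) : ℂ) * x ∉ periodLatticeGamma1 D.f := by
    obtain ⟨x, hx, h4, h2⟩ := hx
    exact ⟨x, hx, by norm_num [h4], by norm_num [h2]⟩
  simpa using exists_addOrderOf_eq_primePow D hopt Nat.prime_two hx'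

/-! ### §4. The by-name cascade -/

/-- **E-an-221 `ShimuraThreeKernelForcesRationalThreeTorsionAtNine` HOLDS** (the last non-printed stub of the C3 skeleton v33; an g40 FILE 1's
glue `shimuraThreeKernelForcesRationalThreeTorsionAtNine_of_cuspLifting` applied to E-an-128). [cite: Vatsal2005, Thm. 1.17] -/
theorem shimuraThreeKernelForcesRationalThreeTorsionAtNine_holds : ShimuraThreeKernelForcesRationalThreeTorsionAtNine :=
  shimuraThreeKernelForcesRationalThreeTorsionAtNine_of_cuspLifting shimuraThreeForcesRationalThreeTorsion_holds

/-- **`ShimuraThreeForcesRationalThreeTorsionAtTameNine` HOLDS** (an's restriction node at `9 ∥ N`). [cite: Vatsal2005, Thm. 1.17] -/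
theorem shimuraThreeForcesRationalThreeTorsionAtTameNine_holds : ShimuraThreeForcesRationalThreeTorsionAtTameNine :=
  shimuraThreeForcesRationalThreeTorsionAtTameNine_of_cuspLifting shimuraThreeForcesRationalThreeTorsion_holds

/-- **`PlusIndexPrimeToThreeOfNoRationalThreeTorsion` HOLDS**: no rational short `3`-torsion on the lattice-optimal minimal curve at `9 ∣ N` ⟹ the
plus index is prime to `3`. [cite: Vatsal2005, Thm. 1.17] [cite: LingOesterle1991, §1] -/
theorem plusIndexPrimeToThreeOfNoRationalThreeTorsion_holds : PlusIndexPrimeToThreeOfNoRationalThreeTorsion :=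
  plusIndexPrimeToThreeOfNoRationalThreeTorsion_of_cuspLifting shimuraThreeForcesRationalThreeTorsion_holds

/-- **`PlusIndexPrimeToThreeOfMuThreeAt27` HOLDS.** [cite: Vatsal2005, Thm. 1.17] -/
theorem plusIndexPrimeToThreeOfMuThreeAt27_holds : PlusIndexPrimeToThreeOfMuThreeAt27 :=
  plusIndexPrimeToThreeOfMuThreeAt27_of_cuspLifting shimuraThreeForcesRationalThreeTorsion_holds

/-- **`PlusIndexPrimeToThreeOfMuThreeNoRationalThreeTorsion` HOLDS.** [cite: Vatsal2005, Thm. 1.17] -/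
theorem plusIndexPrimeToThreeOfMuThreeNoRationalThreeTorsion_holds : PlusIndexPrimeToThreeOfMuThreeNoRationalThreeTorsion :=
  plusIndexPrimeToThreeOfMuThreeNoRationalThreeTorsion_of_cuspLifting shimuraThreeForcesRationalThreeTorsion_holds

end Summit.BirchSwinnertonDyer.BirchSwinnertonDyer.Theorems.ManinLocalTwoThree.CuspLifting
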